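import Literature.Analysis.Hypoelliptic.VFlat
import Mathlib.Analysis.Calculus.VectorField
import HarnessLib

/-!
# Coefficient families versus vector fields: realness, Lie brackets, locality, words

Analysis/Hypoelliptic support file serving the discharge of
`Literature.Analysis.Distribution.Hormander1967_thm11`, continuing `VFlat.lean`.

* `RealFam a` (conjugation-invariant coefficients) and its propagation to brackets;
* `vfR e a y = ∑_l Re(a_l y) • e_l`, the vector field of a family, and
  **`lieBracket (vfR a) (vfR b) = vfR (brC a b)`** for real smooth families (`lieBracket_vfR`);
* locality of the Lie bracket and of `vfR`;
* for the words of `VFlat`: if the base families represent the vector fields `±X_j` on an open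
  set `B`, then `vfR (Fw w) = σ_w • (iterated bracket of the X's)` on `B` (`vfR_Fw_eqOn`).

## References

* L. Hörmander, Acta Math. 119 (1967), Thm 1.1 (folklore bookkeeping).
-/

noncomputable section

open Set Filter Function SchwartzMap VectorField
open scoped Topology ComplexConjugate InnerProductSpace BigOperators ContDiff

namespace Literature.Analysis.Hypoelliptic

variable {V : Type*} [NormedAddCommGroup V] [InnerProductSpace ℝ V]
variable {n : ℕ} {e : Fin n → V}

/-! ### Real families -/

/-- Conjugation-invariant ("real") coefficient families. [folklore] -/
def RealFam (a : Fin n → V → ℂ) : Prop := ∀ l y, conj (a l y) = a l y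

omit [NormedAddCommGroup V] [InnerProductSpace ℝ V] in
/-- The imaginary parts of a real family vanish. [folklore] -/
theorem RealFam.im_eq_zero {a : Fin n → V → ℂ} (ha : RealFam a) (l : Fin n) (y : V) : (a l y).im = 0 := by
  have := ha l y
  exact Complex.conj_eq_iff_im.1 this

omit [NormedAddCommGroup V] [InnerProductSpace ℝ V] in
/-- A real family is the complexification of its real part. [folklore] -/
theorem RealFam.ofReal_re {a : Fin n → V → ℂ} (ha : RealFam a) (l : Fin n) (y : V) :
    ((a l y).re : ℂ) = a l y := by
  apply Complex.ext <;> simp [ha.im_eq_zero l y]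

/-- Derivatives of conjugation-invariant smooth functions are conjugation-invariant. [folklore] -/
theorem conj_fderiv_apply {g : V → ℂ} (hg : ∀ y, conj (g y) = g y) (hd : Differentiable ℝ g) (y v : V) :
    conj (fderiv ℝ g y v) = fderiv ℝ g y v := by
  have h1 : (fun y => conj (g y)) = g := funext hg
  have h2 : HasFDerivAt (fun y => conj (g y)) ((Complex.conjCLE : ℂ →L[ℝ] ℂ).comp (fderiv ℝ g y)) y :=
    (Complex.conjCLE : ℂ →L[ℝ] ℂ).hasFDerivAt.comp y (hd y).hasFDerivAt
  rw [h1] at h2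
  have := congrArg (fun f : V →L[ℝ] ℂ => f v) h2.fderiv
  simp only [ContinuousLinearMap.coe_comp, Function.comp_apply, ContinuousLinearEquiv.coe_coe,
    Complex.conjCLE_apply] at this
  exact this.symm

/-- `∂_l` of a real smooth function is real. [folklore] -/
theorem conj_pd {g : V → ℂ} (hg : ∀ y, conj (g y) = g y) (hd : ContDiff ℝ ∞ g) (l : Fin n) (y : V) :
    conj (pd e l g y) = pd e l g y :=
  conj_fderiv_apply hg (hd.differentiable (by simp)) y (e l)

/-- The derivation of real families on real functions is real. [folklore] -/
theorem RealFam.conj_XdC {a : Fin n → V → ℂ} (ha : RealFam a) {g : V → ℂ} (hg : ∀ y, conj (g y) = g y)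
    (hd : ContDiff ℝ ∞ g) (y : V) : conj (XdC e a g y) = XdC e a g y := by
  simp only [XdC, map_sum, map_mul, ha _ y, conj_pd hg hd]

/-- Brackets of real smooth families are real. [folklore] -/
theorem RealFam.bracket {a b : Fin n → V → ℂ} (ha : RealFam a) (hb : RealFam b) (has : SmoothFam a)
    (hbs : SmoothFam b) : RealFam (brC e a b) := fun m y => by
  simp only [brC, map_sub, ha.conj_XdC (hb m) (hbs m), hb.conj_XdC (ha m) (has m)]

/-- Coefficient families are real. [folklore] -/
theorem CoefFam.realFam (F : CoefFam V n) :
    RealFam F.fn := fun l y => by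
  simp only [CoefFam.fn, map_add, Complex.conj_ofReal, F.real l y]

/-! ### The vector field of a family -/

variable (e) in
/-- `vfR a y = ∑_l Re (a_l y) • e_l`. [folklore] -/
def vfR (a : Fin n → V → ℂ) (y : V) : V := ∑ l, (a l y).re • e l

/-- Smoothness of `vfR`. [folklore] -/
theorem SmoothFam.contDiff_vfR {a : Fin n → V → ℂ} (ha : SmoothFam a) : ContDiff ℝ ∞ (vfR e a) := by
  unfold vfR
  exact ContDiff.sum fun l _ => (Complex.reCLM.contDiff.comp (ha l)).smul contDiff_const

/-- The derivative of `vfR b` in the direction `w`. [folklore] -/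
theorem fderiv_vfR {b : Fin n → V → ℂ} (hb : SmoothFam b) (y w : V) :
    fderiv ℝ (vfR e b) y w = ∑ m, (fderiv ℝ (b m) y w).re • e m := by
  unfold vfR
  have hd : ∀ m, DifferentiableAt ℝ (fun y => (b m y).re • e m) y := fun m =>
    ((Complex.reCLM.differentiable.comp ((hb m).differentiable (by simp))).differentiableAt).smul
      (differentiableAt_const _)
  rw [fderiv_fun_sum fun m _ => hd m]
  rw [show (∑ m ∈ Finset.univ, fderiv ℝ (fun y => (b m y).re • e m) y) w =
    ∑ m ∈ Finset.univ, fderiv ℝ (fun y => (b m y).re • e m) y w from by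
    simp only [FunLike.coe_sum, Finset.sum_apply]]
  refine Finset.sum_congr rfl fun m _ => ?_
  have hbm : DifferentiableAt ℝ (b m) y := ((hb m).differentiable (by simp)).differentiableAt
  have hre : DifferentiableAt ℝ (fun y => (b m y).re) y := Complex.reCLM.differentiableAt.comp y hbm
  rw [fderiv_fun_smul hre (differentiableAt_const _)]
  simp only [fderiv_fun_const, Pi.zero_apply, smul_zero, zero_add, ContinuousLinearMap.smulRight_apply]
  congr 1
  have : fderiv ℝ (fun y => (b m y).re) y = Complex.reCLM.comp (fderiv ℝ (b m) y) :=
    (Complex.reCLM.hasFDerivAt.comp y hbm.hasFDerivAt).fderiv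
  rw [this]
  rfl

/-- The derivative of `vfR b` along `vfR a` is `∑_m Re(X b_m) e_m` for real `a`. [folklore] -/
theorem fderiv_vfR_vfR {a b : Fin n → V → ℂ} (ha : RealFam a) (hb : SmoothFam b) (y : V) :
    fderiv ℝ (vfR e b) y (vfR e a y) = ∑ m, (XdC e a (b m) y).re • e m := by
  rw [fderiv_vfR hb]
  refine Finset.sum_congr rfl fun m _ => ?_
  congr 1
  unfold vfR XdC
  rw [map_sum (fderiv ℝ (b m) y), Complex.re_sum, Complex.re_sum]
  refine Finset.sum_congr rfl fun l _ => ?_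
  rw [(fderiv ℝ (b m) y).map_smul, Complex.real_smul, pd_apply, Complex.mul_re, Complex.mul_re, ha.im_eq_zero l y,
    zero_mul, sub_zero, Complex.ofReal_re, Complex.ofReal_im, zero_mul, sub_zero]

/-- **The Lie bracket of the vector fields of two real smooth families is the vector field of
their coordinate bracket.** [folklore] -/
theorem lieBracket_vfR {a b : Fin n → V → ℂ} (ha : RealFam a) (hb : RealFam b) (has : SmoothFam a)
    (hbs : SmoothFam b) (y : V) :
    lieBracket ℝ (vfR e a) (vfR e b) y = vfR e (brC e a b) y := by
  rw [lieBracket, fderiv_vfR_vfR ha hbs, fderiv_vfR_vfR hb has]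
  unfold vfR
  rw [← Finset.sum_sub_distrib]
  refine Finset.sum_congr rfl fun m _ => ?_
  rw [← sub_smul]
  show (_ : ℝ) • e m = (XdC e a (b m) y - XdC e b (a m) y).re • e m
  rw [Complex.sub_re]

/-- For an orthonormal basis `e` and a family `a_l = ⟪X, e_l⟫ · ρ`-type real data:
`vfR` of the coordinate family of a vector field is the field. [folklore] -/
theorem vfR_coord (b : OrthonormalBasis (Fin n) ℝ V) (X : V → V) (ρ : V → ℝ) (y : V) :
    vfR (fun i => b i) (fun i y => ((ρ y * ⟪X y, b i⟫_ℝ : ℝ) : ℂ)) y = ρ y • X y := by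
  unfold vfR
  simp only [Complex.ofReal_re]
  rw [show (∑ i, (ρ y * ⟪X y, b i⟫_ℝ) • b i) = ρ y • ∑ i, ⟪X y, b i⟫_ℝ • b i from by
    rw [Finset.smul_sum]
    refine Finset.sum_congr rfl fun i _ => ?_
    rw [mul_smul]]
  congr 1
  conv_rhs => rw [← b.sum_repr' (X y)]
  refine Finset.sum_congr rfl fun i _ => ?_
  rw [real_inner_comm]

/-! ### Locality -/

/-- Families that agree near `y` have the same `vfR` near `y`. [folklore] -/
theorem vfR_congr_eventually {a a' : Fin n → V → ℂ} {y : V} (h : ∀ l, a l =ᶠ[𝓝 y] a' l) :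
    vfR e a =ᶠ[𝓝 y] vfR e a' := by
  have hall : ∀ᶠ z in 𝓝 y, ∀ l, a l z = a' l z := by
    rw [Filter.eventually_all]; exact h
  filter_upwards [hall] with z hz
  simp [vfR, hz]

/-! ### Words: `vfR (Fw w)` versus iterated brackets of vector fields -/

section Words

variable {J : ℕ}

/-- Iterated Lie brackets of a family of vector fields `X_j`, `X₀` along a word. [folklore] -/
def vbr (X : Fin J → V → V) (X0 : V → V) : BWord J → V → V
  | BWord.base j => X j
  | BWord.base0 => X0
  | BWord.consJ j w => lieBracket ℝ (X j) (vbr X X0 w)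
  | BWord.cons0 w => lieBracket ℝ X0 (vbr X X0 w)

/-- The sign of a word relative to a NEGATED drift: flips at each occurrence of `X₀`. [folklore] -/
def sgn0 : BWord J → ℝ
  | BWord.base _ => 1
  | BWord.base0 => -1
  | BWord.consJ _ w => sgn0 w
  | BWord.cons0 w => -sgn0 w

/-- Smoothness of the iterated brackets of smooth fields. [folklore] -/
theorem contDiff_vbr {X : Fin J → V → V} {X0 : V → V} (hX : ∀ j, ContDiff ℝ ∞ (X j)) (hX0 : ContDiff ℝ ∞ X0) :
    ∀ w : BWord J, ContDiff ℝ ∞ (vbr X X0 w)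
  | BWord.base j => hX j
  | BWord.base0 => hX0
  | BWord.consJ j w => by
    have ih := contDiff_vbr hX hX0 w
    unfold vbr lieBracket
    exact ((ih.fderiv_right (m := ∞) (mod_cast le_top)).clm_apply (hX j)).sub
      (((hX j).fderiv_right (m := ∞) (mod_cast le_top)).clm_apply ih)
  | BWord.cons0 w => by
    have ih := contDiff_vbr hX hX0 w
    unfold vbr lieBracket
    exact ((ih.fderiv_right (m := ∞) (mod_cast le_top)).clm_apply hX0).sub
      ((hX0.fderiv_right (m := ∞) (mod_cast le_top)).clm_apply ih)

variable {fams : Fin J → CoefFam V n} {fam0 : CoefFam V n}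

/-- The `x`-side word families are real. [folklore] -/
theorem realFam_Fw : ∀ w : BWord J, RealFam (Fw (e := e) fams fam0 w)
  | BWord.base j => (fams j).realFam
  | BWord.base0 => fam0.realFam
  | BWord.consJ j w => (fams j).realFam.bracket (realFam_Fw w) (fams j).smooth (smoothFam_Fw w)
  | BWord.cons0 w => fam0.realFam.bracket (realFam_Fw w) fam0.smooth (smoothFam_Fw w)

/-- **`vfR (Fw w) = sgn0 w • vbr w` on an open set `B`** on which the base families represent
`X_j` and `-X₀`. [folklore] -/
theorem vfR_Fw_eqOn {X : Fin J → V → V} {X0 : V → V} (hX : ∀ j, ContDiff ℝ ∞ (X j)) (hX0 : ContDiff ℝ ∞ X0)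
    {B : Set V} (hB : IsOpen B)
    (hbase : ∀ j, EqOn (vfR e (fams j).fn) (X j) B) (hbase0 : EqOn (vfR e fam0.fn) (fun y => -X0 y) B) :
    ∀ w : BWord J, EqOn (vfR e (Fw (e := e) fams fam0 w)) (fun y => sgn0 w • vbr X X0 w y) B
  | BWord.base j => fun y hy => by simp [Fw, sgn0, vbr, hbase j hy]
  | BWord.base0 => fun y hy => by simp [Fw, sgn0, vbr, hbase0 hy]
  | BWord.consJ j w => fun y hy => by
    have ih := vfR_Fw_eqOn hX hX0 hB hbase hbase0 w
    simp only [Fw, sgn0, vbr]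
    rw [← lieBracket_vfR (fams j).realFam (realFam_Fw w) (fams j).smooth (smoothFam_Fw w)]
    have h1 : vfR e (fams j).fn =ᶠ[𝓝 y] X j :=
      Filter.eventuallyEq_of_mem (hB.mem_nhds hy) (hbase j)
    have h2 : vfR e (Fw (e := e) fams fam0 w) =ᶠ[𝓝 y] fun y => sgn0 w • vbr X X0 w y :=
      Filter.eventuallyEq_of_mem (hB.mem_nhds hy) ih
    rw [h1.lieBracket_vectorField_eq h2]
    rw [show (fun y => sgn0 w • vbr X X0 w y) = sgn0 w • vbr X X0 w from rfl,
      lieBracket_const_smul_right (((contDiff_vbr hX hX0 w).differentiable (by simp)).differentiableAt)]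
  | BWord.cons0 w => fun y hy => by
    have ih := vfR_Fw_eqOn hX hX0 hB hbase hbase0 w
    simp only [Fw, sgn0, vbr]
    rw [← lieBracket_vfR fam0.realFam (realFam_Fw w) fam0.smooth (smoothFam_Fw w)]
    have h1 : vfR e fam0.fn =ᶠ[𝓝 y] fun y => -X0 y :=
      Filter.eventuallyEq_of_mem (hB.mem_nhds hy) hbase0
    have h2 : vfR e (Fw (e := e) fams fam0 w) =ᶠ[𝓝 y] fun y => sgn0 w • vbr X X0 w y :=
      Filter.eventuallyEq_of_mem (hB.mem_nhds hy) ih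
    rw [h1.lieBracket_vectorField_eq h2]
    rw [show (fun y => sgn0 w • vbr X X0 w y) = sgn0 w • vbr X X0 w from rfl,
      lieBracket_const_smul_right (((contDiff_vbr hX hX0 w).differentiable (by simp)).differentiableAt),
      show (fun y => -X0 y) = (-1 : ℝ) • X0 from by ext; simp,
      lieBracket_const_smul_left ((hX0.differentiable (by simp)).differentiableAt), smul_smul, mul_neg_one]

end Words

end Literature.Analysis.Hypoelliptic
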